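import Mathlib
import Summits.Parity.BatemanHorn.Theses.PolynomialMobius
import Summits.Parity.BatemanHorn.Theses.IsogenyRedei
import Summits.Parity.BatemanHorn.Theses.CyclotomicTower
import Summits.Parity.BatemanHorn.Theses.CrossedSalie
import Summits.Parity.BatemanHorn.Theses.GaussianFractions
import Summits.Parity.BatemanHorn.Theorems.PolyMobiusTail.Negative.Equivalence
import Summits.Parity.BatemanHorn.Theorems.IsogenyRedeiTypeIMainTerm
import Summits.Parity.BatemanHorn.Theorems.IsogenyRedeiLambdaToCount
import Summits.Parity.BatemanHorn.Theorems.PolynomialMobiusPolyMobiusTailCountToLambdaSandwich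
import HarnessLib

/-!
# Crux `PolyMobiusTail` (stmt-Parity-0870) IS the sub-problem statement `BatemanHorn`
# — SUMMIT-EQUIVALENCE certificate (lead prover-line-stmt-Parity-0870-c8-0, re-audit bin HONEST)

Helper file `--supports stmt-Parity-0870` (line `eta-free-multilinear-window`, registered skeleton
`Cruxes/PolyMobiusTail/Lines/stub_large.lean` v6).  It certifies by ONE kernel-checked declaration,
`polyMobiusTail_iff_batemanHorn : PolyMobiusTail ↔ BatemanHorn`, that crux r2 of route
PolynomialMobius (and the verbatim cruxes of IsogenyRedei / CyclotomicTower / CrossedSalie /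
GaussianFractions) is not a reduction of the summit conjunct `Summit.Parity.BatemanHorn`
(`= Literature.NumberTheory.Sieve.BatemanHornConjecture`, Bateman–Horn 1962 (1), COUNT form, BY NAME)
but the conjunct itself.

* `→` (`batemanHorn_of_polyMobiusTail`) is the route's deciding theorem `closes` with its two
  theorem-grade supports discharged by the tree (`typeIMainTerm_proof`, stmt-Parity-0873;
  `lambdaToCount_proof`, stmt-Parity-0874).
* `←` (`polyMobiusTail_of_batemanHorn`) is NEW: for every Bateman–Horn system the COUNT asymptotic
  `#{n ≤ x : all fᵢ(n) prime} ∼ C/(∏ deg fᵢ) · x/(log x)^k` implies the `Λ`-asymptotic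
  `Σ_{n ≤ x} ∏ Λ(fᵢ(n)) ∼ C x` (`lambda_isEquivalent_of_batemanHornAsymptotic`: the reverse partial-summation
  sandwich `isEquivalent_sum_of_card_good` of `…PolyMobiusTailCountToLambdaSandwich.lean`, plus the
  landed Bombieri–Pila sparsity of proper prime-power values `LambdaToCount.card_filter_bad_le`), and
  `Λ`-Bateman–Horn for every system is the crux by the landed
  `Negative.Equivalence.polyMobiusTail_iff_lambdaBatemanHorn` (with `typeIMainTerm_proof`).
* Slice-wise (`tail_slice_iff_batemanHornAsymptotic`): for ONE system `f` the crux slice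
  `∃ η ∈ (0,1), Tail_η(f) = o(x)` is EXACTLY `BatemanHornAsymptotic f` — e.g. for `(X, X+2)` the
  Hardy–Littlewood twin asymptotic, for `X² + 1` Landau's problem in asymptotic (Conjecture E) form.

Consequences recorded for planners: every line / decomposition / refutation of the crux is one of
`BatemanHornConjecture` verbatim; the route's remaining items (`TypeIMainTerm`, `LambdaToCount`,
`Assembly`) are landed glue, so route PolynomialMobius carries no reduction at r2.
-/

open Finset Filter Asymptotics Polynomial ArithmeticFunction
open scoped Classical Topology

namespace Summit.Parity.BatemanHorn.Theorems.PolyMobiusTail.SummitEquivalence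

open Literature.NumberTheory.Sieve
open Summit.Parity.BatemanHorn.LambdaToCount
open Summit.Parity.BatemanHorn.Theorems (typeIMainTerm_proof)
open Summit.Parity.BatemanHorn.Theorems.PolyMobiusTail.Negative (polyMobiusTail_iff_lambdaBatemanHorn
  tail_isLittleO_of_isEquivalent)

/-! ### Count-form Bateman–Horn ⇒ `Λ`-form Bateman–Horn, per system -/

/-- **Count ⇒ `Λ`, per system.** For a Bateman–Horn system `f` with constant `C > 0`, the count
asymptotic `BatemanHornAsymptotic f` (`P_f(x) ∼ C/(∏ deg fᵢ) · x/(log x)^k`) implies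
`Σ_{n ≤ x} ∏ᵢ Λ(fᵢ(n)) ∼ C x`: reverse partial summation (`isEquivalent_sum_of_card_good` with
`w(n) = ∏ log fᵢ(n) ∼ (∏ deg fᵢ)(log n)^k`, `LambdaToCount.isEquivalent_prod_log`) plus the sparsity
of proper prime-power values (`LambdaToCount.card_filter_bad_le`, Bombieri–Pila). The converse is the
landed `lambdaToCount_proof` (stmt-Parity-0874). [folklore] -/
theorem lambda_isEquivalent_of_batemanHornAsymptotic {k : ℕ} {f : Fin k → ℤ[X]}
    (hf : IsBatemanHornSystem f) {C : ℝ} (hC : 0 < C) (hHas : HasBatemanHornConst f C)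
    (hBH : BatemanHornAsymptotic f) :
    (fun x : ℕ => ∑ n ∈ Icc 1 x, ∏ i, Λ (((f i).eval (n : ℤ)).toNat)) ~[atTop]
      fun x : ℕ => C * (x : ℝ) := by
  obtain ⟨C', hHas', hP⟩ := hBH
  have hCC : C = C' := tendsto_nhds_unique hHas hHas'
  subst hCC
  set D : ℝ := ∏ i, ((f i).natDegree : ℝ) with hD
  have hD0 : 0 < D := prod_pos fun i _ => by exact_mod_cast hf.natDegree_pos i
  obtain ⟨K, hK⟩ := card_filter_bad_le hf
  set good : ℕ → Prop := fun n => ∀ i, 0 < (f i).eval (n : ℤ) ∧ (((f i).eval (n : ℤ)).toNat).Prime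
    with hgood_def
  set bad : ℕ → Prop := fun n => ∃ i, ∃ p a : ℕ, p.Prime ∧ 2 ≤ a ∧
    ((f i).eval (n : ℤ)).toNat = p ^ a with hbad_def
  have hbad : ∀ n : ℕ, ∏ i, Λ (((f i).eval (n : ℤ)).toNat) ≠ 0 → ¬good n → bad n := by
    intro n h0 hng
    refine exists_eq_prime_pow _ h0 fun hall => hng fun i => ⟨?_, hall i⟩
    exact Int.lt_toNat.mp (hall i).pos
  -- `polyPrimeCount` versus the count over `1 ≤ n ≤ x`
  have hPQ : ∀ x : ℕ, (#((Icc 1 x).filter good) : ℝ) ≤ polyPrimeCount f x ∧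
      (polyPrimeCount f x : ℝ) ≤ #((Icc 1 x).filter good) + 1 := by
    intro x
    have hP : polyPrimeCount f x = #((range (x + 1)).filter good) := by
      unfold polyPrimeCount
      convert rfl
    have h1 : #((Icc 1 x).filter good) ≤ #((range (x + 1)).filter good) := by
      refine card_le_card fun n hn => ?_
      rw [mem_filter, mem_Icc] at hn
      exact mem_filter.mpr ⟨mem_range.mpr (by omega), hn.2⟩
    have h2 : #((range (x + 1)).filter good) ≤ #((Icc 1 x).filter good) + 1 := by
      refine (card_le_card fun n hn => ?_).trans (card_insert_le 0 _)
      rw [mem_filter, mem_range] at hn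
      rw [mem_insert, mem_filter, mem_Icc]
      rcases Nat.eq_zero_or_pos n with h | h
      · exact Or.inl h
      · exact Or.inr ⟨⟨h, by omega⟩, hn.2⟩
    rw [hP]
    exact ⟨by exact_mod_cast h1, by exact_mod_cast h2⟩
  -- the count over `1 ≤ n ≤ x` has the same asymptotic as `polyPrimeCount`
  have hg : Tendsto (fun x : ℕ => ‖C / D * (x : ℝ) / Real.log x ^ k‖) atTop atTop :=
    tendsto_norm_main_term hC hD0 k
  have hP' : (fun x : ℕ => (polyPrimeCount f x : ℝ)) ~[atTop]
      fun x : ℕ => C / D * (x : ℝ) / Real.log x ^ k := by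
    refine hP.congr_right (Eventually.of_forall fun x => ?_)
    simp only [Fintype.card_fin, hD]
  have hr : (fun x : ℕ => (#((Icc 1 x).filter good) : ℝ) - polyPrimeCount f x) =o[atTop]
      fun x : ℕ => C / D * (x : ℝ) / Real.log x ^ k := by
    refine IsBigO.trans_isLittleO ?_ ((isLittleO_one_left_iff ℝ).mpr hg)
    refine IsBigO.of_bound 1 (Eventually.of_forall fun x => ?_)
    obtain ⟨h1, h2⟩ := hPQ x
    rw [Real.norm_eq_abs, norm_one, mul_one, abs_le]
    constructor <;> linarith
  have hQ : (fun x : ℕ => (#((Icc 1 x).filter good) : ℝ)) ~[atTop]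
      fun x => C * (x : ℝ) / (D * Real.log x ^ k) := by
    have h := hP'.add_isLittleO hr
    refine (h.congr_left (Eventually.of_forall fun x => ?_)).congr_right
      (Eventually.of_forall fun x => ?_)
    · simp only [Pi.add_apply]
      ring
    · simp only
      ring
  exact isEquivalent_sum_of_card_good k C D K hC hD0
    (fun n => ∏ i, Real.log ((((f i).eval (n : ℤ)).toNat : ℕ) : ℝ))
    (fun n => ∏ i, Λ (((f i).eval (n : ℤ)).toNat)) good bad
    (fun n => prod_vonMangoldt_nonneg _) (fun n => prod_vonMangoldt_le_prod_log _)
    (fun n hn => prod_vonMangoldt_eq_prod_log _ fun i => (hn i).2) hbad hK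
    (isEquivalent_prod_log hf) hQ

/-! ### The crux is the summit conjunct -/

/-- **Slice-wise exactness.** For ONE Bateman–Horn system `f`, the crux slice
`∃ η ∈ (0,1), Tail_η(f; x) = o(x)` is EQUIVALENT to the Bateman–Horn count asymptotic
`BatemanHornAsymptotic f` (unconditionally: the Type-I main term `typeIMainTerm_proof` and
`lambdaToCount_proof` are tree theorems; `←` by `lambda_isEquivalent_of_batemanHornAsymptotic` and
`Negative.Equivalence.tail_isLittleO_of_isEquivalent`).  E.g. the slice `(X, X+2)` is the
Hardy–Littlewood twin asymptotic and the slice `X² + 1` is Conjecture E in asymptotic form. [folklore] -/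
theorem tail_slice_iff_batemanHornAsymptotic {k : ℕ} {f : Fin k → ℤ[X]} (hf : IsBatemanHornSystem f) :
    (∃ η : ℝ, 0 < η ∧ η < 1 ∧
      (fun x : ℕ => ∑ n ∈ Finset.Icc 1 x,
        ∑ d ∈ Fintype.piFinset (fun i => (((f i).eval (n : ℤ)).toNat).divisors),
          if (x : ℝ) ^ (1 - η) < ∏ i, (d i : ℝ) then
            ∏ i, ((ArithmeticFunction.moebius (d i) : ℝ) * Real.log (d i)) else 0)
        =o[atTop] fun x : ℕ => (x : ℝ)) ↔ BatemanHornAsymptotic f := by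
  constructor
  · rintro ⟨η, hη0, hη1, hT⟩
    obtain ⟨C, hC, hHas, hM⟩ := typeIMainTerm_proof k f hf η hη0 hη1
    have hB := (hT.const_mul_left ((-1 : ℝ) ^ k)).trans_isBigO
      (isBigO_self_const_mul hC.ne' (fun x : ℕ => (x : ℝ)) atTop)
    refine lambdaToCount_proof k f hf C hC hHas ?_
    refine (hM.add_isLittleO hB).congr_left (Eventually.of_forall fun x => ?_)
    simp only [Pi.add_apply]
    rw [Negative.sum_prod_vonMangoldt_eq_typeI_add_tail f η x, mul_add]
  · intro hBH
    refine ⟨1 / 2, by norm_num, by norm_num, ?_⟩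
    obtain ⟨C, hC, hHas, hM⟩ := typeIMainTerm_proof k f hf (1 / 2) (by norm_num) (by norm_num)
    exact tail_isLittleO_of_isEquivalent f
      (lambda_isEquivalent_of_batemanHornAsymptotic hf hC hHas hBH) hM

/-- **`BatemanHorn ⟹ PolyMobiusTail` (NEW direction).** The sub-problem statement
`Summit.Parity.BatemanHorn` (`= Literature.NumberTheory.Sieve.BatemanHornConjecture`, count form) implies
the crux of route PolynomialMobius: count ⇒ `Λ` per system (`lambda_isEquivalent_of_batemanHornAsymptotic`),
then `Λ`-Bateman–Horn for every system is the crux (`Negative.Equivalence.polyMobiusTail_iff_lambdaBatemanHorn`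
with the tree theorem `typeIMainTerm_proof`). [folklore] -/
theorem polyMobiusTail_of_batemanHorn (hBH : _root_.BatemanHorn) :
    Summit.Parity.BatemanHorn.Theses.PolynomialMobius.PolyMobiusTail := by
  have h : Summit.Parity.BatemanHorn.Theses.IsogenyRedei.PolyMobiusTail := by
    refine (polyMobiusTail_iff_lambdaBatemanHorn typeIMainTerm_proof).mpr fun k f hf => ?_
    obtain ⟨C, hC, hHas, -⟩ := typeIMainTerm_proof k f hf (1 / 2) (by norm_num) (by norm_num)
    exact ⟨C, hC, hHas, lambda_isEquivalent_of_batemanHornAsymptotic hf hC hHas (hBH k f hf)⟩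
  exact h

/-- **`PolyMobiusTail ⟹ BatemanHorn`**: the route's deciding theorem `closes` with its two
theorem-grade supports discharged by the tree (`typeIMainTerm_proof`, `lambdaToCount_proof`). [folklore] -/
theorem batemanHorn_of_polyMobiusTail
    (h : Summit.Parity.BatemanHorn.Theses.PolynomialMobius.PolyMobiusTail) : _root_.BatemanHorn :=
  Summit.Parity.BatemanHorn.Theses.PolynomialMobius.closes h typeIMainTerm_proof lambdaToCount_proof

/-- **SUMMIT EQUIVALENCE (the certificate).** Crux r2 of route PolynomialMobius is EQUIVALENT to the
sub-problem statement `Summit.Parity.BatemanHorn` — the Bateman–Horn conjecture in its printed count form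
(Bateman–Horn, Math. Comp. 16 (1962), (1)), BY NAME.  Hence the route is not a reduction at r2: every
line, decomposition or refutation of the crux is one of the summit conjunct itself. [folklore] -/
theorem polyMobiusTail_iff_batemanHorn :
    Summit.Parity.BatemanHorn.Theses.PolynomialMobius.PolyMobiusTail ↔ _root_.BatemanHorn :=
  ⟨batemanHorn_of_polyMobiusTail, polyMobiusTail_of_batemanHorn⟩

/-- The same equivalence with the Literature name of the conjecture. [folklore] -/
theorem polyMobiusTail_iff_batemanHornConjecture :
    Summit.Parity.BatemanHorn.Theses.PolynomialMobius.PolyMobiusTail ↔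
      Literature.NumberTheory.Sieve.BatemanHornConjecture :=
  polyMobiusTail_iff_batemanHorn

/-- The identical crux decl of route IsogenyRedei (verbatim also CyclotomicTower / CrossedSalie /
GaussianFractions) is likewise the summit conjunct. [folklore] -/
theorem polyMobiusTail_isogenyRedei_iff_batemanHorn :
    Summit.Parity.BatemanHorn.Theses.IsogenyRedei.PolyMobiusTail ↔ _root_.BatemanHorn :=
  polyMobiusTail_iff_batemanHorn

/-- The identical crux decl of route CyclotomicTower is the summit conjunct. [folklore] -/
theorem polyMobiusTail_cyclotomicTower_iff_batemanHorn :
    Summit.Parity.BatemanHorn.Theses.CyclotomicTower.PolyMobiusTail ↔ _root_.BatemanHorn :=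
  polyMobiusTail_iff_batemanHorn

/-- The identical crux decl of route CrossedSalie is the summit conjunct. [folklore] -/
theorem polyMobiusTail_crossedSalie_iff_batemanHorn :
    Summit.Parity.BatemanHorn.Theses.CrossedSalie.PolyMobiusTail ↔ _root_.BatemanHorn :=
  polyMobiusTail_iff_batemanHorn

/-- The identical crux decl of route GaussianFractions is the summit conjunct. [folklore] -/
theorem polyMobiusTail_gaussianFractions_iff_batemanHorn :
    Summit.Parity.BatemanHorn.Theses.GaussianFractions.PolyMobiusTail ↔ _root_.BatemanHorn :=
  polyMobiusTail_iff_batemanHorn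

/-- **All five cruxes sharing stmt-Parity-0870 are one statement, the summit conjunct**: the
`PolyMobiusTail` decls of routes PolynomialMobius, IsogenyRedei, CyclotomicTower, CrossedSalie and
GaussianFractions are pairwise equivalent and each is equivalent to `BatemanHorn`. [folklore] -/
theorem polyMobiusTail_all_routes_iff_batemanHorn :
    (Summit.Parity.BatemanHorn.Theses.PolynomialMobius.PolyMobiusTail ↔ _root_.BatemanHorn) ∧
    (Summit.Parity.BatemanHorn.Theses.IsogenyRedei.PolyMobiusTail ↔ _root_.BatemanHorn) ∧
    (Summit.Parity.BatemanHorn.Theses.CyclotomicTower.PolyMobiusTail ↔ _root_.BatemanHorn) ∧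
    (Summit.Parity.BatemanHorn.Theses.CrossedSalie.PolyMobiusTail ↔ _root_.BatemanHorn) ∧
    (Summit.Parity.BatemanHorn.Theses.GaussianFractions.PolyMobiusTail ↔ _root_.BatemanHorn) :=
  ⟨polyMobiusTail_iff_batemanHorn, polyMobiusTail_isogenyRedei_iff_batemanHorn,
    polyMobiusTail_cyclotomicTower_iff_batemanHorn, polyMobiusTail_crossedSalie_iff_batemanHorn,
    polyMobiusTail_gaussianFractions_iff_batemanHorn⟩

end Summit.Parity.BatemanHorn.Theorems.PolyMobiusTail.SummitEquivalence
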